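import Summits.QuantumFields.YangMills.Theorems.IR.AfPincerUcTypChain
import Summits.QuantumFields.YangMills.Theorems.BalabanLadderIRTypBallSparseScales
import HarnessLib

/-!
# Crux `IR` (stmt-QuantumFields-19354), line `af-pincer-Uc`: PEIERLS RARITY OF LONG BAD CHAINS for the short-chain class
# `TypChain` (1/2) — the abstract hereditary `η ^ #F` bound from sparseness of bad plaquette SETS, and clause (ii) (UKP)
# reduced by name to kernel sparseness

Helper module for item `stmt-QuantumFields-19354` (`--supports … --as helper`; it closes nothing).  Slot of record «sharp merge
I♯_SC» (owner R104, `Cruxes/IR/Lines/af_pincer_Uc_sharp.lean`, sha16 `28967a1bf60ad397`): open stub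
`stub_onsetSharpSC : AfPincerUc.SharpOnset.OnsetSharpUKPcSC` (LEAD ym-lead-19354-af-pincer).  The LEAD's R107/R109-compliant class of
record is the SHORT-CHAIN class `SharpLanes.TypChain ρ θ w ℓ₀` (`Theorems/IR/AfPincerUcTypChain.lean`, p537603: no `θ`-bad chain of
`ℓ∞`-extent `≥ ℓ₀` among a cell's own plaquettes), and its next supplier statement `TypChainSharpSC` (LANES-R104 rev 3 §7b) has three
conjuncts per mesh-`b` frame: (i) `ClauseIAll` (the open content, R107 (c)), (ii) `ClauseIIukp … (TypChain …)`, (iii)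
`ClauseIII … b δ (TypChain …)` — «(ii)/(iii) = a collar-typical PEIERLS bound on long bad chains at `b ≍ 1/a`, NOT given by the tree's
any-exterior large-field lemma (boundary term)».  This file (seat ym-19354-afpincer-s1 g2) does the Peierls bookkeeping ONCE, abstractly;
its sequel `AfPincerUcTypChainTorusAnchor` DISCHARGES (iii) from the tree's odd-torus chessboard estimate.

* §1 Peierls counting (`exists_stepFinset`, `exists_chainFinset`; adapted from the private lemmas of
  `Theorems/ConvexGribovBodyNonSimplyConnectedLatticeGapStubLongBadChainsRareOfChessboard`, re-stated for `supNormZ4` to stay in this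
  helper's import cone): chains of `k + 1` plaquettes with `ℓ∞`-steps `≤ 2` from a start set `B` number `≤ #B · 3750^k`.
* §2 **`measure_forall_hasBadChainAmong_le_pow` — the abstract HEREDITARY Peierls bound.**  For ANY measure `μ` read through ANY map
  `Φ : Ω → LGConfig 4 G` (sequel: `Φ = torusLift (2S+1)`; §3: `Φ = id`), pairwise disjoint cells `P c` (`c ∈ F`) of `≤ n` plaquettes
  inside a universe `𝒰`, and the chessboard-shaped SPARSENESS hypothesis `μ{∀ p ∈ X, θ ≤ plaqAction ρ p ∘ Φ} ≤ q ^ #X` for all `X ⊆ 𝒰`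
  (`3750 q ≤ 1/2`): `μ{∀ c ∈ F, HasBadChainAmong ρ θ (P c) ℓ₀ ∘ Φ} ≤ (2 n q (3750 q)^{⌈ℓ₀/2⌉}) ^ #F`.  (Induction on `F` uniformly in an
  extra set of plaquettes required bad; loop erasure `exists_injective_chain`; the sparseness exponents of disjoint cells ADD — this is what
  makes the bound a pure power, the shape clauses (ii)/(iii) demand.)
* §3 `disjoint_cellPlaqs`; `clauseIIukp_typChain_of_kernelSparse` — clause (ii) (UKP) for `TypChain` REDUCED BY NAME to «UKP sparseness of
  bad plaquette SETS under the guarded DLR kernels» (`Φ = id`, `n = 96 b⁴ ≥ #cellPlaqs`).  The hypothesis is the (ii)-side research content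
  and is NOT proved here; located remark in its docstring (the any-exterior lemma `IRKernelLargeField.kernel_measureReal_le_actionIn_le_of_subset`
  is boundary-dominated for thin `X`; without the format's guard the hypothesis is false at one plaquette forced by a frustrated exterior).

NOT done here: clause (i) for collars carrying short chains (R107 (c)) and the kernel sparseness of §3 — the open content of
`stub_onsetSharpSC`; clause (iii) is the sequel's.  HONEST FRAMING: Peierls bookkeeping around ONE open stub of a CONDITIONAL chain
(Track A 0/28 UV); nothing of weak-coupling mixing, asymptotic freedom or a gap is proved or claimed; not infinite volume, not Clay.
No `sorry`; axioms ⊆ {propext, Classical.choice, Quot.sound}.  References: R. Peierls, Proc. Camb. Phil. Soc. 32 (1936) 477; E. Seiler,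
LNP 159 (1982) Ch. 3.
-/

set_option autoImplicit false

noncomputable section

open MeasureTheory
open Literature.MathematicalPhysics.QuantumFieldTheory hiding ZdEdge
open Literature.MathematicalPhysics.QuantumLattice
open Literature.Probability.LatticeModels (Site)
open Summit.QuantumFields.YangMills.Cruxes.IR.Tempered (regionEdges)
open Summit.QuantumFields.YangMills.Theorems.OddTorusChessboard (cellPlaqs plaqAction cellSites
  fst_mem_cellSites_of_mem_cellPlaqs disjoint_cellSites card_cellPlaqs_le Orient card_orient_four)

namespace Summit.QuantumFields.YangMills.Cruxes.IR.AfPincerUc.SharpLanes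

open Summit.QuantumFields.YangMills.Cruxes.IR.AfPincerUc

/-! ## §1 Peierls counting: chains of `k + 1` plaquettes with `ℓ∞`-steps `≤ 2` from a finite start set -/
section Counting

-- (membership in a closed `Finset` of plaquettes makes `whnf` evaluate it: raise the recursion limit for this declaration)
set_option maxRecDepth 20000 in
/-- The step alphabet: the `5⁴ · 6 = 3750` plaquettes with base point in `[−2, 2]⁴` (displacement × orientation)
(adapted from the tree's private `NonSimplyConnectedLatticeGap.exists_stepFinset`, stated for `supNormZ4`). -/
theorem exists_stepFinset : ∃ D : Finset (ZdPlaquette 4), D.card = 3750 ∧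
    ∀ (x : Site 4) (o : {p : Fin 4 × Fin 4 // p.1 < p.2}), supNormZ4 x ≤ 2 → (x, o) ∈ D := by
  refine ⟨(Fintype.piFinset fun _ : Fin 4 => Finset.Icc (-2 : ℤ) 2) ×ˢ Finset.univ, ?_, fun x o hx => ?_⟩
  · have h6 : Fintype.card {p : Fin 4 × Fin 4 // p.1 < p.2} = 6 := by decide
    simp only [Finset.card_product, Fintype.card_piFinset, Finset.prod_const, Finset.card_univ,
      Fintype.card_fin, Int.card_Icc, h6]
    decide
  · refine Finset.mem_product.2 ⟨Fintype.mem_piFinset.2 fun i => Finset.mem_Icc.2 ?_, Finset.mem_univ _⟩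
    have h := (supNormZ4_le_iff.1 hx) i
    show -2 ≤ x i ∧ x i ≤ 2
    omega

/-- **Peierls counting** (adapted from the tree's private `NonSimplyConnectedLatticeGap.exists_chainFinset`).  The chains of
`k + 1` plaquettes starting in `B` with consecutive base points within `ℓ∞`-distance `2` lie in a Finset of cardinality
`≤ #B · 3750 ^ k` (append one step at a time, `Fin.snoc`). -/
theorem exists_chainFinset (B : Finset (ZdPlaquette 4)) : ∀ k : ℕ,
    ∃ T : Finset (Fin (k + 1) → ZdPlaquette 4), T.card ≤ B.card * 3750 ^ k ∧
      ∀ c : Fin (k + 1) → ZdPlaquette 4, c 0 ∈ B →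
        (∀ i : Fin k, supNormZ4 ((c i.castSucc).1 - (c i.succ).1) ≤ 2) → c ∈ T
  | 0 => by
    refine ⟨B.image fun p _ => p, ?_, fun c h0 _ => ?_⟩
    · rw [pow_zero, mul_one]
      exact Finset.card_image_le
    · exact Finset.mem_image.2 ⟨c 0, h0, funext fun i => by rw [Fin.fin_one_eq_zero i]⟩
  | k + 1 => by
    obtain ⟨T, hT, hmem⟩ := exists_chainFinset B k
    obtain ⟨D, hD, hDmem⟩ := exists_stepFinset
    refine ⟨(T ×ˢ D).image fun cv => Fin.snoc cv.1 ((cv.1 (Fin.last k)).1 - cv.2.1, cv.2.2), ?_,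
      fun c h0 hstep => ?_⟩
    · calc _ ≤ (T ×ˢ D).card := Finset.card_image_le
        _ = T.card * 3750 := by rw [Finset.card_product, hD]
        _ ≤ B.card * 3750 ^ k * 3750 := Nat.mul_le_mul_right _ hT
        _ = B.card * 3750 ^ (k + 1) := by ring
    · have hinit : Fin.init c ∈ T :=
        hmem (Fin.init c) (by rw [show Fin.init c 0 = c 0 from congrArg c Fin.castSucc_zero]; exact h0)
          fun i => by
            have h := hstep i.castSucc
            rw [Fin.succ_castSucc] at h
            exact h
      have hlast : supNormZ4 ((c (Fin.last k).castSucc).1 - (c (Fin.last (k + 1))).1) ≤ 2 := by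
        have h := hstep (Fin.last k)
        rwa [Fin.succ_last] at h
      refine Finset.mem_image.2 ⟨(Fin.init c, ((c (Fin.last k).castSucc).1 - (c (Fin.last (k + 1))).1,
        (c (Fin.last (k + 1))).2)), Finset.mem_product.2 ⟨hinit, hDmem _ _ hlast⟩, ?_⟩
      show Fin.snoc (Fin.init c) ((Fin.init c (Fin.last k)).1 -
          ((c (Fin.last k).castSucc).1 - (c (Fin.last (k + 1))).1), (c (Fin.last (k + 1))).2) = c
      rw [show Fin.init c (Fin.last k) = c (Fin.last k).castSucc from rfl, sub_sub_cancel, Prod.mk.eta]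
      exact Fin.snoc_init_self c

end Counting

/-! ## §2 The abstract hereditary Peierls bound: sparseness of bad plaquette SETS ⇒ rarity of long bad chains in
disjoint cells, in the multiplicative shape `η ^ #F` -/
section Peierls

variable {G : Type} [Group G] {N : ℕ} (ρ : G →* Matrix (Fin N) (Fin N) ℂ)
variable {Ω : Type*} [MeasurableSpace Ω]

/-- **Abstract hereditary Peierls bound.**  Let `μ` be any measure on a space `Ω` of data read as lattice gauge
configurations through `Φ : Ω → LGConfig 4 G` (below: `Φ = torusLift (2S+1)` for the torus states, `Φ = id` for the DLR
kernels), `θ` a badness threshold, and `(P c)_{c ∈ F}` finitely many pairwise DISJOINT plaquette sets («cells») inside a finite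
universe `𝒰`, each with at most `n` plaquettes.  SPARSENESS HYPOTHESIS (chessboard shape): for every `X ⊆ 𝒰`,
`μ{∀ p ∈ X, θ ≤ plaqAction ρ p (Φ ω)} ≤ q ^ #X`, with `0 ≤ q` and `3750 q ≤ 1/2`.  CONCLUSION: the event «EVERY cell `P c`,
`c ∈ F`, carries a `θ`-bad chain (steps `≤ 2` in `ℓ∞`) of extent `≥ ℓ₀` among its own plaquettes» (`HasBadChainAmong`) has
`μ`-measure `≤ η ^ #F`, `η = 2 n q (3750 q)^{⌈ℓ₀/2⌉}` (`⌈ℓ₀/2⌉ = (ℓ₀ + 1) / 2` in `ℕ`).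
Proof (Peierls 1936): induction on the family, uniformly in an extra set `X` of plaquettes required bad; in a new cell a long
bad chain contains an INJECTIVE one of `K + 1` plaquettes, `ℓ₀ ≤ 2K` (`exists_injective_chain`), disjoint from `X` and from
the other cells, so the sparseness exponent adds up; there are `≤ n · 3750 ^ K` such chains (`exists_chainFinset`) and
`∑_{K ≥ ⌈ℓ₀/2⌉} n 3750^K q^{K+1} ≤ 2 n q (3750 q)^{⌈ℓ₀/2⌉}`. -/
theorem measure_forall_hasBadChainAmong_le_pow (μ : Measure Ω) (Φ : Ω → LGConfig 4 G) (θ : ℝ)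
    {ι : Type*} (F : Finset ι) (P : ι → Finset (ZdPlaquette 4)) (𝒰 : Finset (ZdPlaquette 4))
    (hP𝒰 : ∀ c ∈ F, P c ⊆ 𝒰) (hdisj : ∀ c ∈ F, ∀ c' ∈ F, c ≠ c' → Disjoint (P c) (P c'))
    {n : ℕ} (hn : ∀ c ∈ F, (P c).card ≤ n) {q : ℝ} (hq0 : 0 ≤ q) (hq : 3750 * q ≤ 1 / 2)
    (hsp : ∀ X : Finset (ZdPlaquette 4), X ⊆ 𝒰 →
      μ {ω | ∀ p ∈ X, θ ≤ plaqAction ρ p (Φ ω)} ≤ ENNReal.ofReal (q ^ X.card))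
    (ℓ₀ : ℕ) :
    μ {ω | ∀ c ∈ F, HasBadChainAmong ρ θ (↑(P c)) ℓ₀ (Φ ω)} ≤
      ENNReal.ofReal ((2 * n * q * (3750 * q) ^ ((ℓ₀ + 1) / 2)) ^ F.card) := by
  classical
  set K₀ : ℕ := (ℓ₀ + 1) / 2 with hK₀
  set η : ℝ := 2 * n * q * (3750 * q) ^ K₀ with hη
  have hη0 : 0 ≤ η := by positivity
  have hr0 : 0 ≤ 3750 * q := by positivity
  have hr1 : 3750 * q < 1 := by linarith
  -- the induction over sub-families `F' ⊆ F`, uniformly in an extra plaquette set `X` required bad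
  suffices key : ∀ F' : Finset ι, F' ⊆ F → ∀ X : Finset (ZdPlaquette 4), X ⊆ 𝒰 → (∀ c ∈ F', Disjoint X (P c)) →
      μ {ω | (∀ p ∈ X, θ ≤ plaqAction ρ p (Φ ω)) ∧ ∀ c ∈ F', HasBadChainAmong ρ θ (↑(P c)) ℓ₀ (Φ ω)} ≤
        ENNReal.ofReal (q ^ X.card * η ^ F'.card) by
    have h := key F subset_rfl ∅ (Finset.empty_subset _) (fun c _ => Finset.disjoint_empty_left _)
    rw [Finset.card_empty, pow_zero, one_mul] at h
    refine (measure_mono ?_).trans h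
    intro ω hω
    exact ⟨fun p hp => absurd hp (Finset.notMem_empty p), hω⟩
  intro F'
  induction F' using Finset.induction_on with
  | empty =>
    intro _ X hX _
    rw [Finset.card_empty, pow_zero, mul_one]
    refine (measure_mono ?_).trans (hsp X hX)
    intro ω hω
    exact hω.1
  | insert a s ha ih =>
    intro hsub X hX hdX
    have haF : a ∈ F := hsub (Finset.mem_insert_self a s)
    have hsF : s ⊆ F := fun c hc => hsub (Finset.mem_insert_of_mem hc)
    -- chain Finsets from the start set `P a`
    choose T hTcard hTmem using fun m : ℕ => exists_chainFinset (P a) (K₀ + m)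
    -- the events «the admissible chain `ch` is entirely bad, `X` is bad, the cells of `s` carry long bad chains»
    let E : (m : ℕ) → (Fin (K₀ + m + 1) → ZdPlaquette 4) → Set Ω := fun m ch =>
      {ω | (Function.Injective ch ∧ ∀ i, ch i ∈ P a) ∧
        (∀ p ∈ X ∪ Finset.univ.image ch, θ ≤ plaqAction ρ p (Φ ω)) ∧
          ∀ c ∈ s, HasBadChainAmong ρ θ (↑(P c)) ℓ₀ (Φ ω)}
    -- (1) covering (loop erasure)
    have hcover : {ω | (∀ p ∈ X, θ ≤ plaqAction ρ p (Φ ω)) ∧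
        ∀ c ∈ insert a s, HasBadChainAmong ρ θ (↑(P c)) ℓ₀ (Φ ω)} ⊆ ⋃ m : ℕ, ⋃ ch ∈ T m, E m ch := by
      rintro ω ⟨hXω, hch⟩
      obtain ⟨k, c, hin, hbad, hstep, hext⟩ := hch a (Finset.mem_insert_self a s)
      obtain ⟨K, c', hinj, hQ, hstep', hD⟩ := exists_injective_chain
        (Q := fun p => p ∈ P a ∧ θ ≤ plaqAction ρ p (Φ ω)) c (fun i => ⟨Finset.mem_coe.1 (hin i), hbad i⟩) hstep hext
      have hK : K₀ ≤ K := by omega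
      obtain ⟨m, rfl⟩ := Nat.exists_eq_add_of_le hK
      refine Set.mem_iUnion.2 ⟨m, Set.mem_iUnion₂.2 ⟨c', hTmem m c' (hQ 0).1 hstep', ?_⟩⟩
      refine ⟨⟨hinj, fun i => (hQ i).1⟩, fun p hp => ?_, fun c hc => hch c (Finset.mem_insert_of_mem hc)⟩
      rcases Finset.mem_union.1 hp with hpX | hpI
      · exact hXω p hpX
      · obtain ⟨i, -, rfl⟩ := Finset.mem_image.1 hpI
        exact (hQ i).2
    -- (2) each event: empty, or the induction hypothesis at `X ∪ image ch`
    have hE : ∀ (m : ℕ) (ch : Fin (K₀ + m + 1) → ZdPlaquette 4),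
        μ (E m ch) ≤ ENNReal.ofReal (q ^ (X.card + (K₀ + m + 1)) * η ^ s.card) := by
      intro m ch
      by_cases hadm : Function.Injective ch ∧ ∀ i, ch i ∈ P a
      · have himg : Finset.univ.image ch ⊆ P a := by
          intro p hp
          obtain ⟨i, -, rfl⟩ := Finset.mem_image.1 hp
          exact hadm.2 i
        have hX' : X ∪ Finset.univ.image ch ⊆ 𝒰 := Finset.union_subset hX (himg.trans (hP𝒰 a haF))
        have hdX' : ∀ c ∈ s, Disjoint (X ∪ Finset.univ.image ch) (P c) := by
          intro c hc
          have hac : a ≠ c := fun h => ha (h ▸ hc)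
          exact Finset.disjoint_union_left.2
            ⟨hdX c (Finset.mem_insert_of_mem hc), (hdisj a haF c (hsF hc) hac).mono_left himg⟩
        have hcardX' : (X ∪ Finset.univ.image ch).card = X.card + (K₀ + m + 1) := by
          rw [Finset.card_union_of_disjoint ((hdX a (Finset.mem_insert_self a s)).mono_right himg),
            Finset.card_image_of_injective _ hadm.1, Finset.card_univ, Fintype.card_fin]
        have e : E m ch = {ω | (∀ p ∈ X ∪ Finset.univ.image ch, θ ≤ plaqAction ρ p (Φ ω)) ∧
            ∀ c ∈ s, HasBadChainAmong ρ θ (↑(P c)) ℓ₀ (Φ ω)} := by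
          ext ω
          simp only [E, Set.mem_setOf_eq]
          exact ⟨fun h => h.2, fun h => ⟨hadm, h⟩⟩
        rw [e, ← hcardX']
        exact ih hsF _ hX' hdX'
      · have e : E m ch = ∅ := Set.eq_empty_of_forall_notMem fun ω hω => hadm hω.1
        rw [e, measure_empty]
        exact bot_le
    -- (3) counting
    set A : ℝ := q ^ X.card * η ^ s.card * (n * q * (3750 * q) ^ K₀) with hA
    have hA0 : 0 ≤ A := by positivity
    have hcard : ∀ m : ℕ, ((T m).card : ENNReal) * ENNReal.ofReal (q ^ (X.card + (K₀ + m + 1)) * η ^ s.card) ≤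
        ENNReal.ofReal (A * (3750 * q) ^ m) := by
      intro m
      rw [← ENNReal.ofReal_natCast, ← ENNReal.ofReal_mul (by positivity)]
      refine ENNReal.ofReal_le_ofReal ?_
      have hc : ((T m).card : ℝ) ≤ n * 3750 ^ (K₀ + m) := by
        have h' : ((T m).card : ℝ) ≤ (P a).card * 3750 ^ (K₀ + m) := by exact_mod_cast hTcard m
        have hn' : ((P a).card : ℝ) ≤ n := by exact_mod_cast hn a haF
        exact h'.trans (by gcongr)
      calc ((T m).card : ℝ) * (q ^ (X.card + (K₀ + m + 1)) * η ^ s.card)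
          ≤ n * 3750 ^ (K₀ + m) * (q ^ (X.card + (K₀ + m + 1)) * η ^ s.card) := by gcongr
        _ = A * (3750 * q) ^ m := by rw [hA]; ring
    -- (4) summation
    have hsum : HasSum (fun m : ℕ => A * (3750 * q) ^ m) (A * (1 - 3750 * q)⁻¹) :=
      (hasSum_geometric_of_lt_one hr0 hr1).mul_left _
    have hμ : μ (⋃ m : ℕ, ⋃ ch ∈ T m, E m ch) ≤ ENNReal.ofReal (A * (1 - 3750 * q)⁻¹) :=
      calc μ (⋃ m : ℕ, ⋃ ch ∈ T m, E m ch)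
          ≤ ∑' m, μ (⋃ ch ∈ T m, E m ch) := measure_iUnion_le _
        _ ≤ ∑' m, ∑ ch ∈ T m, μ (E m ch) := ENNReal.tsum_le_tsum fun m => measure_biUnion_finset_le _ _
        _ ≤ ∑' m, ∑ ch ∈ T m, ENNReal.ofReal (q ^ (X.card + (K₀ + m + 1)) * η ^ s.card) :=
          ENNReal.tsum_le_tsum fun m => Finset.sum_le_sum fun ch _ => hE m ch
        _ = ∑' m, ((T m).card : ENNReal) * ENNReal.ofReal (q ^ (X.card + (K₀ + m + 1)) * η ^ s.card) := by
          simp only [Finset.sum_const, nsmul_eq_mul]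
        _ ≤ ∑' m, ENNReal.ofReal (A * (3750 * q) ^ m) := ENNReal.tsum_le_tsum fun m => hcard m
        _ = ENNReal.ofReal (A * (1 - 3750 * q)⁻¹) := by
          rw [← ENNReal.ofReal_tsum_of_nonneg (fun m => mul_nonneg hA0 (pow_nonneg hr0 _)) hsum.summable,
            hsum.tsum_eq]
    refine ((measure_mono hcover).trans hμ).trans (ENNReal.ofReal_le_ofReal ?_)
    have hinv : (1 - 3750 * q)⁻¹ ≤ 2 :=
      inv_le_of_inv_le₀ (by norm_num) (by rw [inv_eq_one_div]; linarith)
    rw [Finset.card_insert_of_notMem ha, pow_succ]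
    calc A * (1 - 3750 * q)⁻¹ ≤ A * 2 := by gcongr
      _ = q ^ X.card * (η ^ s.card * η) := by rw [hA, hη]; ring

end Peierls

/-! ## §3 Clause (ii) (UKP) for `TypChain`, REDUCED BY NAME to kernel sparseness of bad plaquette SETS -/
section Kernel

variable {G : Type} [Group G] [TopologicalSpace G] [IsTopologicalGroup G] [CompactSpace G]
  [MeasurableSpace G] [BorelSpace G]

omit [TopologicalSpace G] [IsTopologicalGroup G] [CompactSpace G] [MeasurableSpace G] [BorelSpace G] in
/-- Distinct cells of a mesh-`b` frame have disjoint plaquette sets. -/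
theorem disjoint_cellPlaqs {b : ℕ} {w : Fin 4 → ℤ → ℤ} (hw : IsFrame b w) {c c' : Fin 4 → ℤ} (hcc : c ≠ c') :
    Disjoint (cellPlaqs w c) (cellPlaqs w c') := by
  rw [Finset.disjoint_left]
  intro q hq hq'
  exact Finset.disjoint_left.1 (disjoint_cellSites hw hcc) (fst_mem_cellSites_of_mem_cellPlaqs hq)
    (fst_mem_cellSites_of_mem_cellPlaqs hq')

/-- **Clause (ii) in UKP form for `TypChain`, from KERNEL SPARSENESS (a reduction by name — the hypothesis `hsp` is the
research content, NOT proved here).**  `hsp` («UKP large-field sparseness of bad plaquette SETS at `(β, w, θ)` with base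
`q`»): for all finite cell families `F ⊆ F'`, `F` nonempty, every exterior `ζ` satisfying the format's guard (each cell within
sup-distance `1` of a cell of `F` is resampled, `∈ F'`, or `ζ`-typical for `TypChain`), and every set `X` of plaquettes of the
cells of `F`, the DLR kernel of the region `F'` gives `γ_{F'}(ζ){σ | ∀ p ∈ X, θ ≤ plaqAction ρ p σ} ≤ q ^ #X`.  Then, with
`3750 q ≤ 1/2` and the budget `192 b⁴ q (3750 q)^{⌈ℓ₀/2⌉} ≤ δ` of §3, `ClauseIIukp ρ β w δ (TypChain ρ θ w ℓ₀)` holds on the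
mesh-`b` frame `w` (same Peierls bookkeeping as (iii), `Φ = id`).  LOCATED REMARK: the tree's any-exterior large-field
lemma `IRKernelLargeField.kernel_measureReal_le_actionIn_le_of_subset` does NOT give `hsp` for thin `X` (its `2N · n_bd`
boundary term dominates `θ #X`), and `hsp` without the guard is false at a single plaquette forced by a frustrated exterior
— the guard (typical or resampled collar of width `≥ b`) is where the (ii)-side content lives. -/
theorem clauseIIukp_typChain_of_kernelSparse {N : ℕ} (ρ : G →* Matrix (Fin N) (Fin N) ℂ) (β : ℝ) {b : ℕ}
    {w : Fin 4 → ℤ → ℤ} (hw : IsFrame b w) (θ : ℝ) (ℓ₀ : ℕ) {q δ : ℝ} (hq0 : 0 ≤ q) (hq : 3750 * q ≤ 1 / 2)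
    (hδ : 192 * (b : ℝ) ^ 4 * q * (3750 * q) ^ ((ℓ₀ + 1) / 2) ≤ δ)
    (hsp : ∀ F F' : Finset (Fin 4 → ℤ), F ⊆ F' → F.Nonempty → ∀ ζ : LGConfig 4 G,
      (∀ c ∈ F, ∀ c' : Fin 4 → ℤ, (∀ i, |c' i - c i| ≤ 1) → c' ∈ F' ∨ ζ ∈ TypChain ρ θ w ℓ₀ c') →
        ∀ X : Finset (ZdPlaquette 4), X ⊆ F.biUnion (cellPlaqs w) →
          (ymSpecification ρ β (regionEdges w F') ζ) {σ : LGConfig 4 G | ∀ p ∈ X, θ ≤ plaqAction ρ p σ} ≤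
            ENNReal.ofReal (q ^ X.card)) :
    ClauseIIukp ρ β w δ (TypChain ρ θ w ℓ₀) := by
  classical
  intro F F' hFF' hF ζ hguard
  have hn : ∀ c ∈ F, (cellPlaqs w c).card ≤ 96 * b ^ 4 := fun c _ => by
    have h := card_cellPlaqs_le hw c
    rw [card_orient_four] at h
    calc (cellPlaqs w c).card ≤ (2 * b) ^ 4 * 6 := h
      _ = 96 * b ^ 4 := by ring
  have hmain := measure_forall_hasBadChainAmong_le_pow ρ (ymSpecification ρ β (regionEdges w F') ζ) id θ F
    (cellPlaqs w) (F.biUnion (cellPlaqs w)) (fun c hc => Finset.subset_biUnion_of_mem _ hc)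
    (fun c _ c' _ hcc => disjoint_cellPlaqs hw hcc) hn hq0 hq (fun X hX => hsp F F' hFF' hF ζ hguard X hX) ℓ₀
  have hev : {σ : LGConfig 4 G | ∀ c ∈ F, σ ∉ TypChain ρ θ w ℓ₀ c} =
      {σ | ∀ c ∈ F, HasBadChainAmong ρ θ (↑(cellPlaqs w c)) ℓ₀ (id σ)} := by
    ext σ
    simp only [Set.mem_setOf_eq, TypChain, not_not, id]
  rw [hev]
  refine hmain.trans (ENNReal.ofReal_le_ofReal (pow_le_pow_left₀ (by positivity) ?_ _))
  calc 2 * ((96 * b ^ 4 : ℕ) : ℝ) * q * (3750 * q) ^ ((ℓ₀ + 1) / 2)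
      = 192 * (b : ℝ) ^ 4 * q * (3750 * q) ^ ((ℓ₀ + 1) / 2) := by push_cast; ring
    _ ≤ δ := hδ

end Kernel


/-! ## §4 (appended) Clause (iii) is monotone in the class; located STATUS NOTE on §3's remark

STATUS NOTE on the «LOCATED REMARK» in the docstring of `clauseIIukp_typChain_of_kernelSparse` (seat ym-19354-afpincer-s1 g2, same
day): its first clause (the any-exterior large-field lemma is boundary-dominated for thin sets) stands; its second clause («`hsp` without the
guard is false at a single plaquette forced by a frustrated exterior») is a HEURISTIC, NOT a theorem of the tree, and so is the complementary
hope that the guard repairs it: whether an exterior — guarded (TypChain-typical neighbours, e.g. isolated centre dust, or a uniform abelian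
flux `ζ(x,μ) = exp(iσ₃ f Σ_{ν<μ} x_ν)` pinned just below `θ`) or not — forces boundary-adjacent INNER plaquettes of the resampled cell above
`θ` under the kernel is a one-cell variational/Laplace question (per face link exactly one straddling plaquette pulls toward the exterior's
staple and about one in-face inner plaquette resists; for `ζ ≡ 1` with a single centre-twisted link adjacent to the cell the minimiser keeps
every inner plaquette trivial and pays `2N` on the straddle instead).  Consequently the hypothesis `hsp` (sparseness for ALL plaquette sets
of the cells, boundary-adjacent singletons included) is STRONGER than what the Peierls bound consumes (long injective chains only) and may
fail while `ClauseIIukp … (TypChain …)` survives; the abstract bound `measure_forall_hasBadChainAmong_le_pow` is agnostic in the cell sets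
`P c` and serves verbatim any re-typing of the (ii)-side target over interior plaquettes.
NUMERICAL PROBE of the flux adversary (kit job j282534 of this seat, evidence on stmt-QuantumFields-19354; `SU(2)`, one cell `{0..b-1}⁴`,
`b ∈ {6, 8}`, all links outside FIXED to the uniform flux with `s(f) = 2 − 2 cos f ∈ {0.5, 2, 3.6}`, checkerboard cooling = exact coordinate
descent of the energy of all plaquettes touching the cell, 600 sweeps, starts: flux × noise ∕ random ∕ identity): the coldest states found
(flux-noise and random starts agree; total energy `0.08–0.35` of the uniform-flux continuation, i.e. the flux is EXPELLED) have EVERY inner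
plaquette (`cellPlaqs`) strictly BELOW the exterior's level — `max S / s(f) = 0.78–0.90` at `s = 0.5`, `0.27–0.29` at `s = 2`, `0.16–0.17` at
`s = 3.6`, all attained in the boundary layer; depth `≥ 2` plaquettes `≤ 0.02 s(f)` — the mismatch being paid on the STRADDLING plaquettes
(max `2.4–3.9 ≤ 2N`, not in `cellPlaqs`); only the identity start (a higher-energy metastable state, `+15–30 %` energy) traps interior
defects (`s = 0.5`: 76 ∕ 163 inner plaquettes above `s(f)`).  So this adversary does NOT force inner plaquettes above its own level at
`b ≤ 8`; the growth of the boundary-layer ratio with `b` at small `s` (`0.80 → 0.90`, random start) is the open point (b-scan job j282787,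
`b ≤ 12`, same item).  Indicative only (local minima, one adversary family); neither `hsp` nor its negation is claimed. -/
section Mono

variable {G : Type} [Group G] [TopologicalSpace G] [IsTopologicalGroup G] [CompactSpace G]
  [MeasurableSpace G] [BorelSpace G]

/-- **Clause (iii) is monotone in the class**: a pointwise larger family inherits the torus anchor with the same budget (the
failure event «every cell of `F` atypical» shrinks). -/
theorem clauseIII_of_subset {N : ℕ} {ρ : G →* Matrix (Fin N) (Fin N) ℂ} {β : ℝ} {w : Fin 4 → ℤ → ℤ} {b : ℕ} {δ : ℝ}
    {Typ Typ' : (Fin 4 → ℤ) → Set (LGConfig 4 G)} (hsub : ∀ c, Typ c ⊆ Typ' c) (h : ClauseIII ρ β w b δ Typ) :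
    ClauseIII ρ β w b δ Typ' := by
  intro S hS F hF hin
  refine (measure_mono ?_).trans (h S hS F hF hin)
  intro V hV c hc hmem
  exact hV c hc (hsub c hmem)

/-- **Clause (iii) for `TypChain` passes to every larger tolerated extent and every larger badness threshold** (`typChain_mono`):
a supplier may consume `clauseIII_typChain` / `exists_extent_clauseIII_typChain` (sequel `AfPincerUcTypChainTorusAnchor`) at any
`ℓ₀' ≥ ℓ₀`, `θ' ≥ θ`. -/
theorem clauseIII_typChain_mono {N : ℕ} {ρ : G →* Matrix (Fin N) (Fin N) ℂ} {β : ℝ} {w : Fin 4 → ℤ → ℤ} {b : ℕ} {δ : ℝ}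
    {θ θ' : ℝ} {ℓ₀ ℓ₀' : ℕ} (hθ : θ ≤ θ') (hℓ : ℓ₀ ≤ ℓ₀') (h : ClauseIII ρ β w b δ (TypChain ρ θ w ℓ₀)) :
    ClauseIII ρ β w b δ (TypChain ρ θ' w ℓ₀') :=
  clauseIII_of_subset (fun _ => typChain_mono hθ hℓ) h

end Mono

/-! ## §5 (appended) Chains are monotone in the plaquette set; ADDENDUM to §4's status note (b-scan j282787, clusters j283736)
ADDENDUM (numerical; kit jobs j282787 + j283736 of this seat, evidence on stmt-QuantumFields-19354; same probe as §4 — `SU(2)`, one cell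
`{0..b-1}⁴` inside the uniform abelian flux exterior at plaquette level `s = s(f)`, checkerboard cooling to a cold minimiser, 1500 sweeps,
flux-noise ≡ random starts; `b ∈ {6, 8, 10, 12}`).  `r(s) := max_{inner} S / s` at the cold state; inner plaquettes above `s` by step-`2` component:
* `s = 0.10`: `r = 2.1/2.6/2.4` (`b = 6/8/10`); `192/404/815` inner plaquettes above `s` in ONE component of extent `5/7/9 = b − 1` covering
  the whole boundary layer (faces, edges, corners; depth `0`, reaching depth `1` at `b = 10`);
* `s = 0.25`: `r = 1.21–1.37` (`b = 6…12`, no growth in `b`); `12–30` plaquettes above `s` in `5–6` components sitting on the cell's EDGES and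
  CORNERS (base points with `3` resp. `4` boundary coordinates), largest extent `4 / 7 / 8` (`b = 6/8/10`, growing along the edges);
* `s = 0.35`: `r = 1.02/1.14/0.98` (≤ 2 isolated edge plaquettes); `s = 0.5`: `0.77–0.93`; `s = 1`: `0.46–0.50`; `s = 2`: `0.27`; `s = 3.6`:
  `0.16` (none above `s`, stable in `b`); depth `≥ 2` plaquettes `≤ 0.03 s` throughout (interior screened).
READING.  An exterior at level `s < θ` is `TypChain`-typical for `θ` and, at the cold minimiser, forces inner plaquettes up to `r(s)·s`;
since `r(s) > 1` exactly for `s ≲ 0.36`, this adversary family forces `θ`-bad INNER boundary plaquettes iff `θ ≲ 0.36 ≈ θ_force`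
(`SU(2)`, `S ∈ [0,4]`; consistent with ctriage-1's S-147 estimate `θ_force ≈ 0.38`): for `0.25 ≲ θ ≲ 0.36` as isolated edge/corner clusters,
for `θ ≲ 0.3` as edge-long clusters (extent `≍ b`), for `θ ≲ 0.2` as a boundary-layer-spanning component — i.e. there the forced plaquettes
DO chain to extent `b − 1 ≥ ℓ₀`, so not only `hsp` but `ClauseIIukp … (TypChain ρ θ w ℓ₀)` itself is numerically untenable at such small `θ`,
while for `θ ≳ 0.5` the family fails outright (ratio `< 1`, no growth in `b ≤ 12`); the owner's S-147 default `θ = 1` sits above this floor.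
Indicative only (T = 0 cooling minima, one adversary family; a single-face sub-threshold layer does NOT show it: full surround, edges/corners). -/
section MonoSet
variable {G : Type} [Group G] {N : ℕ} {ρ : G →* Matrix (Fin N) (Fin N) ℂ}

/-- Bad chains are monotone in the ambient plaquette set (so «no long bad chain among a SUB-family of the cell's plaquettes», e.g. the
interior ones, defines a class CONTAINING `TypChain`, which inherits clause (iii) by `clauseIII_of_subset`). -/
theorem HasBadChainAmong.mono_set {θ : ℝ} {Pl Pl' : Set (ZdPlaquette 4)} {ℓ : ℕ} {U : LGConfig 4 G} (hPl : Pl ⊆ Pl')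
    (h : HasBadChainAmong ρ θ Pl ℓ U) : HasBadChainAmong ρ θ Pl' ℓ U := by
  obtain ⟨k, c, hin, hbad, hstep, hext⟩ := h
  exact ⟨k, c, fun i => hPl (hin i), hbad, hstep, hext⟩

/-- The short-chain class over a plaquette sub-family `Pl ⊆ cellPlaqs w c` of the cell contains `TypChain ρ θ w ℓ₀ c`. -/
theorem typChain_subset_noChainAmong {θ : ℝ} {w : Fin 4 → ℤ → ℤ} {ℓ₀ : ℕ} {c : Fin 4 → ℤ} {Pl : Set (ZdPlaquette 4)}
    (hPl : Pl ⊆ ↑(cellPlaqs w c)) : TypChain ρ θ w ℓ₀ c ⊆ {U | ¬ HasBadChainAmong ρ θ Pl ℓ₀ U} :=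
  fun _ hU h => hU (h.mono_set hPl)
end MonoSet

end Summit.QuantumFields.YangMills.Cruxes.IR.AfPincerUc.SharpLanes

end
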